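import Summits.BirchSwinnertonDyer.BirchSwinnertonDyer.Theses.UniversalToricDescent
import Summits.BirchSwinnertonDyer.BirchSwinnertonDyer.Theorems.UniversalToricDescentLocalH1DivisibleCurve
import HarnessLib

/-!
# Stub TS2-DIV of line `sigmacongruence` (crux ♭T≤ stmt-BirchSwinnertonDyer-23042): `H¹(K_{∞,w}, E′_K[3^∞])` is `3`-divisible

Width prover `bsd-wall-utd-p1-w2` g0 (explicit unit under LEAD `bsd-wall-utd-p1`; stub mode,
`--supports stmt-BirchSwinnertonDyer-23042`). THEOREMS ONLY; no definition, no named fact, no `sorry`.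
BSD is not proved by any of this.

The registered stub `stub_localH1Divisible` of skeleton v7 (`Cruxes/DefectTransportModThreePT/Lines/sigmacongruence.lean`,
sha `be74f101c7c3…`): for a number field `K`, a `ℤ₃`-extension `κ` of `K` (`ker κ = Gal(K̄/K_∞)`), a finite place
`v ∤ 3` of `K` NOT split completely in `K_∞` (`D_v ⊄ ker κ`, i.e. `v` is finitely decomposed) and an elliptic curve
`E′/ℚ`, every class of `H¹(kerD κ v, E′_K[3^∞]) = H¹(K_{∞,w}, E′_K[3^∞])` is `3` times a class.

This is Greenberg–Vatsal's Prop. (2.4) ("`𝓗_ℓ` is divisible", `cd₃ Gal(K̄_v/K_{∞,w}) ≤ 1`), which the tree ALREADY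
holds for EVERY elliptic curve over `K`, every prime `p`, every `ℤ_p`-extension and every finitely decomposed `v ∤ p`, in
the route's `kerD` currency: `UniversalToricDescentLocalH1Divisible.exists_nsmul_eq_subgroupH1_kerD`
(`Theorems/UniversalToricDescentLocalH1DivisibleCurve.lean`, lead utd-p1 g11; chain: `res : H¹(Hi, A) ⥲ H¹(I ∩ Hi, A)^{Hi}`
with `Hi/I` pro-prime-to-`p`, `H¹(I_{K_v}, A)` `p`-divisible for the local inertia group, averaging over the
pro-prime-to-`p` quotient, and the two tautological transports `localSubgroup ⇄ ker κ ⊓ D_v ⇄ kerD κ v`).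
The stub is that theorem at `W := E′.baseChange K`, `p := 3`.

* `stub_localH1Divisible` — the registered stub, verbatim.

References: [GreenbergVatsal2000] §2 Prop. (2.4) and its proof (arXiv p. 22), p. 24; [GreenbergLNM1716] §3 Lemma 3.3;
[NeukirchSchmidtWingberg2008] (7.1.8)(i).
-/

set_option autoImplicit false
-- `…BirchSwinnertonDyer.BirchSwinnertonDyer…` is the problem's mandated namespace (D-0017).
set_option linter.dupNamespace false

noncomputable section

open scoped Classical

namespace Summit.BirchSwinnertonDyer.BirchSwinnertonDyer.Cruxes.DefectTransportModThreePT.SigmaCongruence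

open WeierstrassCurve NumberField IsDedekindDomain Field
  Literature.NumberTheory.EllipticCurves
  Literature.NumberTheory.EllipticCurves.GreenbergSelmer
  Literature.NumberTheory.GaloisRepresentations
  Summit.BirchSwinnertonDyer.Rank1Residual Summit.BirchSwinnertonDyer.Rank1Residual.X11b
  Summit.BirchSwinnertonDyer.Rank1Residual.X11b.AcSelmer Summit.BirchSwinnertonDyer.Rank1Residual.X11b.Coinv
  Summit.BirchSwinnertonDyer.BirchSwinnertonDyer.Theorems

/-- **STUB TS2-DIV (v7) — PROVED**: at a place `v ∤ 3` finitely decomposed in the `ℤ₃`-extension `κ`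
(`D_v ⊄ ker κ`), `H¹(kerD κ v, E′_K[3^∞]) = H¹(K_{∞,w}, E′_K[3^∞])` is `3`-divisible — Greenberg–Vatsal's Prop. (2.4)
for the base change `E′_K`, i.e. the tree's `UniversalToricDescentLocalH1Divisible.exists_nsmul_eq_subgroupH1_kerD` at
`W := E′.baseChange K`, `p := 3`. [cite: GreenbergVatsal2000, §2 Prop. (2.4) and proof (arXiv p. 22), p. 24]
[cite: GreenbergLNM1716, §3 Lemma 3.3] -/
theorem stub_localH1Divisible :
    ∀ (W' : WeierstrassCurve ℚ) [W'.IsElliptic] (K : Type) [Field K] [NumberField K] (κ : ZpExtension K 3)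
      (v : HeightOneSpectrum (𝓞 K)), ((3 : ℕ) : 𝓞 K) ∉ v.asIdeal → ¬ (decomp v ≤ κ.kerSubgroup) →
      ∀ y : subgroupH1 (kerD κ v) ((W'.baseChange K).geomPrimaryTorsion 3),
        ∃ z : subgroupH1 (kerD κ v) ((W'.baseChange K).geomPrimaryTorsion 3), 3 • z = y := by
  intro W' _ K _ _ κ v hv hvd y
  exact UniversalToricDescentLocalH1Divisible.exists_nsmul_eq_subgroupH1_kerD (W'.baseChange K) κ hv hvd y

end Summit.BirchSwinnertonDyer.BirchSwinnertonDyer.Cruxes.DefectTransportModThreePT.SigmaCongruence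

end
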